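import Mathlib
import Summits.NavierStokesRegularity.NavierStokesRegularity.Theorems.EulerZoomLiouvillePowerGaugeEulerLiouvilleSelfSimilarKelvinFlowC2
import Literature.Analysis.ODE.LiouvilleFormula

/-!
# THE LOCAL LIOUVILLE LAW along lingering backward cut-off orbits: `det DΨ_σ(y) = e^{−3γσ}` (ROUND-40 seed, nsreg-p2 g33)

THE ONE STATEMENT's needle is a divergence-free `C²` profile `U` seen through `C²` CUT-OFF copies `V` (`‖DV‖ ≤ K`, `V = U` on
`ball 0 R_big`); the cut-off is NOT divergence-free off the ball, so the tree's Jacobian law `det_fderiv_flow`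
(…SelfSimilarKelvinFlow: `V ∈ C^∞`, `div V = 0` everywhere, forward time) does not apply to the backward cut-off flow
`Ψ_σ := Φ^V_{−σ}`.  Along orbits that LINGER in `B̄_M ⊂ ball 0 R_big` during `[0, L]` — the orbits of the residence clock
`hclock` of `NeedleRace.curl_eq_zero_of_powerClock_of_strongThinExits` — the Jacobian obeys the exact law nevertheless:

* `hasDerivAt_fderiv_flow_neg_apply` — the backward variational equation `d/dσ DΨ_σ(y)v = −(γ + DV(Ψ_σ y)) DΨ_σ(y)v`;
* `trace_neg_transportDeriv_eq` — on the ball, `tr(−(γI + DV(z))) = −3γ` (`DV = DU` there, `div U = 0`);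
* `det_fderiv_flow_neg_linger` (**local Liouville law**): `∀ σ ∈ [0, L], det DΨ_σ(y) = e^{−3γσ}`
  (Abel–Liouville–Jacobi, `Literature.Analysis.ODE.det_eq_exp_mul_of_trace_eq`);
* `det_fderiv_flow_neg_linger_pos` / `…_le_one` — bookkeeping corollaries (`γ ≥ 0`).

Reading: with the local Cauchy formula (plate t40a: `DΨ_σ(y)Ω(y) = e^{−(1+γ)σ}Ω(Ψ_σ y)`, hence
`‖DΨ_σ(y)Ω̂(y)‖ ≤ (O/‖Ω(y)‖)e^{−(1+γ)σ}`) the law `det = e^{−3γσ}` forces the material area element transverse to `Ω(y)`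
to grow at least like `(‖Ω(y)‖/O)·e^{(1+γ−3γ)σ} = (‖Ω(y)‖/O)·e^{ργσ}`, and `‖DΨ_σ(y)‖ ≥ ((‖Ω(y)‖/O)e^{ργσ})^{1/2}`, along
EVERY lingering vortical orbit (`γ = 1/(2+ρ)`): residence is uniformly hyperbolic at the universal exponent `ργ`.
Not NS, not E. [cite: ConstantinIgnatovaVicol2026Putative, §3.4.1 eq. (3.22); folklore]
-/

open Set Filter Topology Metric Function MeasureTheory
open scoped NNReal ENNReal

set_option linter.dupNamespace false

namespace Summit.NavierStokesRegularity.NavierStokesRegularity.Theorems.PowerGaugeEulerLiouville.NeedleClock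

open Literature.Analysis Literature.Analysis.FluidPDE
open Summit.NavierStokesRegularity.NavierStokesRegularity.Theorems.PowerGaugeEulerLiouville

variable {γ : ℝ} {U V : EuclideanSpace ℝ (Fin 3) → EuclideanSpace ℝ (Fin 3)} {P : EuclideanSpace ℝ (Fin 3) → ℝ}

/-- **Backward variational equation, applied to a vector**: for `V ∈ C²`, `‖DV‖ ≤ K`,
`d/dσ (DΨ_σ(y) v) = −(γ·DΨ_σ(y)v + DV(Ψ_σ y)(DΨ_σ(y) v))`. [cite: ConstantinIgnatovaVicol2026Putative, §3.4.1 eq. (3.22)] -/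
theorem hasDerivAt_fderiv_flow_neg_apply (hV : ContDiff ℝ 2 V) {K : ℝ} (hK : ∀ y, ‖fderiv ℝ V y‖ ≤ K)
    (y v : EuclideanSpace ℝ (Fin 3)) (σ : ℝ) :
    HasDerivAt (fun r => fderiv ℝ (ODE.evolutionMap (fun _ : ℝ => selfSimilarTransport γ 0 V) 0 (-r)) y v)
      (-(γ • fderiv ℝ (ODE.evolutionMap (fun _ : ℝ => selfSimilarTransport γ 0 V) 0 (-σ)) y v +
        fderiv ℝ V (ODE.evolutionMap (fun _ : ℝ => selfSimilarTransport γ 0 V) 0 (-σ) y)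
          (fderiv ℝ (ODE.evolutionMap (fun _ : ℝ => selfSimilarTransport γ 0 V) 0 (-σ)) y v))) σ := by
  have h1 := C2.Kelvin.hasDerivAt_fderiv_flow (γ := γ) hV hK (-σ) y
  have h2 : HasDerivAt (fun r : ℝ => -r) (-1 : ℝ) σ := hasDerivAt_neg σ
  have h3 := (h1.scomp σ h2).clm_apply (hasDerivAt_const σ v)
  simp only [map_zero, add_zero, _root_.smul_apply, ContinuousLinearMap.comp_apply] at h3
  refine h3.congr_deriv ?_
  simp only [_root_.add_apply, _root_.smul_apply, ContinuousLinearMap.id_apply]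
  module

/-- On the ball where the cut-off agrees with the divergence-free profile, the backward transport derivative
`−(γI + DV(z))` has trace `−3γ`. [folklore] -/
theorem trace_neg_transportDeriv_eq (hprof : IsSelfSimilarEulerProfile γ 0 U P) {Rbig : ℝ}
    (hVU : ∀ w ∈ ball (0 : EuclideanSpace ℝ (Fin 3)) Rbig, V w = U w) {z : EuclideanSpace ℝ (Fin 3)}
    (hz : z ∈ ball (0 : EuclideanSpace ℝ (Fin 3)) Rbig) :
    LinearMap.trace ℝ (EuclideanSpace ℝ (Fin 3))
      ((-(γ • ContinuousLinearMap.id ℝ (EuclideanSpace ℝ (Fin 3)) + fderiv ℝ V z) :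
        EuclideanSpace ℝ (Fin 3) →L[ℝ] EuclideanSpace ℝ (Fin 3)) :
        EuclideanSpace ℝ (Fin 3) →ₗ[ℝ] EuclideanSpace ℝ (Fin 3)) = -(3 * γ) := by
  have hVU' : fderiv ℝ V z = fderiv ℝ U z :=
    Filter.EventuallyEq.fderiv_eq (Filter.eventually_of_mem (isOpen_ball.mem_nhds hz) hVU)
  have hdiv : LinearMap.trace ℝ (EuclideanSpace ℝ (Fin 3))
      (fderiv ℝ U z : EuclideanSpace ℝ (Fin 3) →ₗ[ℝ] EuclideanSpace ℝ (Fin 3)) = 0 := hprof.divFree z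
  have h2 : ((-(γ • ContinuousLinearMap.id ℝ (EuclideanSpace ℝ (Fin 3)) + fderiv ℝ V z) :
      EuclideanSpace ℝ (Fin 3) →L[ℝ] EuclideanSpace ℝ (Fin 3)) :
      EuclideanSpace ℝ (Fin 3) →ₗ[ℝ] EuclideanSpace ℝ (Fin 3))
      = -(γ • LinearMap.id + (fderiv ℝ U z : EuclideanSpace ℝ (Fin 3) →ₗ[ℝ] EuclideanSpace ℝ (Fin 3))) := by
    rw [hVU']; rfl
  rw [h2, map_neg, map_add, map_smul, hdiv, LinearMap.trace_id, finrank_euclideanSpace_fin]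
  simp [mul_comm]

/-- **THE LOCAL LIOUVILLE LAW along a lingering backward orbit.**  `(U, P)` a self-similar Euler profile
(`div U = 0`), `V ∈ C²`, `‖DV‖ ≤ K`, `V = U` on `ball 0 R_big`, `M < R_big`; if `‖Ψ_σ y‖ ≤ M` for `σ ∈ [0, L]` then
`det DΨ_σ(y) = e^{−3γσ}` for `σ ∈ [0, L]`. [cite: ConstantinIgnatovaVicol2026Putative, §3.4.1 eq. (3.22)] -/
theorem det_fderiv_flow_neg_linger (hprof : IsSelfSimilarEulerProfile γ 0 U P) (hV : ContDiff ℝ 2 V) {K : ℝ}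
    (hK : ∀ y, ‖fderiv ℝ V y‖ ≤ K) {M Rbig : ℝ} (hMR : M < Rbig)
    (hVU : ∀ w ∈ ball (0 : EuclideanSpace ℝ (Fin 3)) Rbig, V w = U w) {y : EuclideanSpace ℝ (Fin 3)} {L : ℝ}
    (hy : ∀ σ ∈ Icc (0 : ℝ) L, ‖ODE.evolutionMap (fun _ : ℝ => selfSimilarTransport γ 0 V) 0 (-σ) y‖ ≤ M) :
    ∀ σ ∈ Icc (0 : ℝ) L,
      (fderiv ℝ (ODE.evolutionMap (fun _ : ℝ => selfSimilarTransport γ 0 V) 0 (-σ)) y).det =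
        Real.exp (-(3 * γ) * σ) := by
  by_cases hL : 0 ≤ L
  swap
  · intro σ hσ; exact absurd (hσ.1.trans hσ.2) hL
  have hV1 : ContDiff ℝ 1 V := hV.of_le (by norm_num)
  have hzball : ∀ σ ∈ Icc (0 : ℝ) L, ODE.evolutionMap (fun _ : ℝ => selfSimilarTransport γ 0 V) 0 (-σ) y ∈
      ball (0 : EuclideanSpace ℝ (Fin 3)) Rbig :=
    fun σ hσ => mem_ball_zero_iff.2 (lt_of_le_of_lt (hy σ hσ) hMR)
  -- the operator curve and its generator
  set J : ℝ → (EuclideanSpace ℝ (Fin 3) →L[ℝ] EuclideanSpace ℝ (Fin 3)) := fun r =>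
    fderiv ℝ (ODE.evolutionMap (fun _ : ℝ => selfSimilarTransport γ 0 V) 0 (-r)) y with hJ
  set A : ℝ → (EuclideanSpace ℝ (Fin 3) →L[ℝ] EuclideanSpace ℝ (Fin 3)) := fun t =>
    -(γ • ContinuousLinearMap.id ℝ (EuclideanSpace ℝ (Fin 3)) +
      fderiv ℝ V (ODE.evolutionMap (fun _ : ℝ => selfSimilarTransport γ 0 V) 0 (-t) y)) with hA
  have hJ' : ∀ v, ∀ t, HasDerivAt (fun u => J u v) (A t (J t v)) t := by
    intro v t
    have h := hasDerivAt_fderiv_flow_neg_apply (γ := γ) hV hK y v t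
    refine h.congr_deriv ?_
    simp only [hA, hJ, _root_.neg_apply, _root_.add_apply, _root_.smul_apply, ContinuousLinearMap.id_apply]
  -- continuity of the generator
  have hflow : Continuous fun t : ℝ => ODE.evolutionMap (fun _ : ℝ => selfSimilarTransport γ 0 V) 0 (-t) y :=
    continuous_iff_continuousAt.2 fun t => (C2.Kelvin.hasDerivAt_flow_neg (γ := γ) hV1 hK y t).continuousAt
  have hAc : Continuous A := by
    have h1 : Continuous fun t : ℝ =>
        fderiv ℝ V (ODE.evolutionMap (fun _ : ℝ => selfSimilarTransport γ 0 V) 0 (-t) y) :=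
      (hV.continuous_fderiv (by norm_num)).comp hflow
    exact (continuous_const.add h1).neg
  have hJc : ∀ v, ContinuousOn (fun s => J s v) (Icc 0 L) := fun v t _ =>
    (hJ' v t).continuousAt.continuousWithinAt
  have hJ0 : J 0 = ContinuousLinearMap.id ℝ (EuclideanSpace ℝ (Fin 3)) := by
    have hΦ0 : ODE.evolutionMap (fun _ : ℝ => selfSimilarTransport γ 0 V) 0 0 = id :=
      funext (ODE.evolutionMap_self _ 0)
    simp only [hJ, neg_zero, hΦ0, fderiv_id]
  have hd : ∀ s ∈ Icc (0 : ℝ) L, LinearMap.trace ℝ (EuclideanSpace ℝ (Fin 3))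
      (A s : EuclideanSpace ℝ (Fin 3) →ₗ[ℝ] EuclideanSpace ℝ (Fin 3)) = -(3 * γ) := fun s hs =>
    trace_neg_transportDeriv_eq hprof hVU (hzball s hs)
  have hmain := Literature.Analysis.ODE.det_eq_exp_mul_of_trace_eq (E := EuclideanSpace ℝ (Fin 3)) hL
    hAc.continuousOn hJc (fun v t _ => (hJ' v t).hasDerivWithinAt) hJ0 hd
  intro σ hσ
  simpa [hJ] using hmain σ hσ

/-- The backward Jacobian along a lingering orbit is positive. [folklore] -/
theorem det_fderiv_flow_neg_linger_pos (hprof : IsSelfSimilarEulerProfile γ 0 U P) (hV : ContDiff ℝ 2 V) {K : ℝ}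
    (hK : ∀ y, ‖fderiv ℝ V y‖ ≤ K) {M Rbig : ℝ} (hMR : M < Rbig)
    (hVU : ∀ w ∈ ball (0 : EuclideanSpace ℝ (Fin 3)) Rbig, V w = U w) {y : EuclideanSpace ℝ (Fin 3)} {L : ℝ}
    (hy : ∀ σ ∈ Icc (0 : ℝ) L, ‖ODE.evolutionMap (fun _ : ℝ => selfSimilarTransport γ 0 V) 0 (-σ) y‖ ≤ M)
    {σ : ℝ} (hσ : σ ∈ Icc (0 : ℝ) L) :
    0 < (fderiv ℝ (ODE.evolutionMap (fun _ : ℝ => selfSimilarTransport γ 0 V) 0 (-σ)) y).det := by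
  rw [det_fderiv_flow_neg_linger hprof hV hK hMR hVU hy σ hσ]; exact Real.exp_pos _

/-- For `γ ≥ 0` the backward flow contracts volume along lingering orbits: `det DΨ_σ(y) ≤ 1`. [folklore] -/
theorem det_fderiv_flow_neg_linger_le_one (hprof : IsSelfSimilarEulerProfile γ 0 U P) (hγ : 0 ≤ γ)
    (hV : ContDiff ℝ 2 V) {K : ℝ} (hK : ∀ y, ‖fderiv ℝ V y‖ ≤ K) {M Rbig : ℝ} (hMR : M < Rbig)
    (hVU : ∀ w ∈ ball (0 : EuclideanSpace ℝ (Fin 3)) Rbig, V w = U w) {y : EuclideanSpace ℝ (Fin 3)} {L : ℝ}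
    (hy : ∀ σ ∈ Icc (0 : ℝ) L, ‖ODE.evolutionMap (fun _ : ℝ => selfSimilarTransport γ 0 V) 0 (-σ) y‖ ≤ M)
    {σ : ℝ} (hσ : σ ∈ Icc (0 : ℝ) L) :
    (fderiv ℝ (ODE.evolutionMap (fun _ : ℝ => selfSimilarTransport γ 0 V) 0 (-σ)) y).det ≤ 1 := by
  rw [det_fderiv_flow_neg_linger hprof hV hK hMR hVU hy σ hσ, Real.exp_le_one_iff]
  have : 0 ≤ 3 * γ * σ := by have := hσ.1; positivity
  linarith

end Summit.NavierStokesRegularity.NavierStokesRegularity.Theorems.PowerGaugeEulerLiouville.NeedleClock
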